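import Summits.KontsevichZagierPeriods.KontsevichZagierPeriods.Theses.SymplecticScissors
import Literature.NumberTheory.Transcendental.AyoubPeriodSeries
import Literature.NumberTheory.Transcendental.AyoubPeriodSeriesKernel
import Literature.NumberTheory.Transcendental.AyoubPeriodSeriesPiAlgebraic
import Literature.NumberTheory.Transcendental.AyoubPeriodSeriesLocalizing
import Literature.NumberTheory.Transcendental.AyoubPeriodSeriesProofs
import Summits.KontsevichZagierPeriods.KontsevichZagierPeriods.Theorems.SymplecticScissorsTypeAGenerationRatOneVarLayer
import Summits.KontsevichZagierPeriods.KontsevichZagierPeriods.Theorems.SymplecticScissorsTypeAGenerationStubTransposition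
import Summits.KontsevichZagierPeriods.KontsevichZagierPeriods.Theorems.SymplecticScissorsTypeAGenerationStubPdzCalculus
import Summits.KontsevichZagierPeriods.KontsevichZagierPeriods.Theorems.SymplecticScissorsTypeAGenerationStubPdzMemOan
import Summits.KontsevichZagierPeriods.KontsevichZagierPeriods.Theorems.SymplecticScissorsTypeAGenerationStubRestrCOne
import Summits.KontsevichZagierPeriods.KontsevichZagierPeriods.Theorems.SymplecticScissorsTypeAGenerationStubRestrCZero
import Summits.KontsevichZagierPeriods.KontsevichZagierPeriods.Theorems.SymplecticScissorsTypeAGenerationStubCovPolyAux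
import Summits.KontsevichZagierPeriods.KontsevichZagierPeriods.Theorems.SymplecticScissorsTypeAGenerationStubRoomLemmaIter
import Summits.KontsevichZagierPeriods.KontsevichZagierPeriods.Theorems.SymplecticScissorsTypeAGenerationRoomNormalisation
import Summits.KontsevichZagierPeriods.KontsevichZagierPeriods.Theorems.TypeAGeneration.Negative.HypothesesAudit
import Mathlib.RingTheory.MvPowerSeries.Rename

/-!
# `TypeAGeneration` (stmt-KontsevichZagierPeriods-18392), line `Sketch`: finite sums of
one-variable RATIONAL pieces with vanishing total integral (registered stub
`stub_multiPieceRatLayer`, F2)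

**Theorem (F2).** Let `h₀, …, h_{m-1} ∈ 𝒪_{ℚ-alg}(𝔻̄^∞)` (`AyoubRel.Oan (algebraMap ℚ ℂ)`), each
`h_p` involving only the variable `z_{ι p}` and RATIONAL in it with algebraic coefficients
(`B_p · h_p = A_p`, `A_p, B_p ∈ ℚ̄[z_{ι p}]`, `B_p ≠ 0`). If the TOTAL integral `∫ Σ_p h_p`
vanishes, then `Σ_p h_p` lies in the `ℚ`-span of the type-(a) elements
`∂G/∂zₙ − G|_{zₙ=1} + G|_{zₙ=0}`, `G ∈ 𝒪_{ℚ-alg}(𝔻̄^∞)` (the individual integrals need not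
vanish, e.g. `1/(2 + z₀) − 1/(3 − z₁)`).

Proof. Move every piece to a common FRESH variable `z_t` (`t = 1 + max ι`) with the landed
transposition `stub_transposition` (`h_p − h_p^{(ι p t)}` is type (a), `h_p` being free of
`z_t`). The moved sum `H = Σ_p h_p^{(ι p t)}` is a one-variable rational element of
`𝒪_{ℚ-alg}(𝔻̄^∞)`: each `h_p^{(ι p t)} = h_p − (h_p − h_p^{(ι p t)})` lies in `𝒪_{ℚ-alg}(𝔻̄^∞)`
because the span does (landed membership of `∂ᵢG`, `G|_{zᵢ=1}`, `G|_{zᵢ=0}`: W2, S4, S8), it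
involves only `z_t`, and renaming the relation `B_p(z_{ι p}) h_p = A_p(z_{ι p})` gives
`B_p(z_t) h_p^{(ι p t)} = A_p(z_t)`; sums of such elements are rational (common denominator
`Π_p B_p`). Moreover `∫ H = ∫ Σ_p h_p − ∫ (Σ_p h_p − H) = 0` since the span integrates to zero
(`TypeAGenerationNegative.intC_eq_zero_of_mem_kSpan_relAC`). The landed LAYER 1 (`l1_layer_rat`)
puts `H` in the span, hence `Σ_p h_p = (Σ_p h_p − H) + H` as well.
References: Ayoub, Ann. of Math. 181 (2015), Conj. 1.1, Rem. 1.5; Fresán 2024, Conj. 3.5.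
Helper names carry the prefix `f2_`; no definition is introduced.
-/

noncomputable section

-- `Summit.KontsevichZagierPeriods.KontsevichZagierPeriods.…` is the tree's mandated layout (single-conjunct summit).
set_option linter.dupNamespace false

namespace Summit.KontsevichZagierPeriods.KontsevichZagierPeriods.TypeAGenerationLine

open Finsupp MvPowerSeries
open Literature.NumberTheory.Transcendental
open Literature.NumberTheory.Transcendental.AyoubRel
open Summit.KontsevichZagierPeriods.SymplecticScissors.TypeAGenerationNegative
  (intC_eq_zero_of_mem_kSpan_relAC)

/-! ## The span of type (a) lies in `𝒪_{k-alg}(𝔻̄^∞)` -/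

/-- A type-(a) element `∂ₙG − G|_{zₙ=1} + G|_{zₙ=0}`, `G ∈ 𝒪_{k-alg}(𝔻̄^∞)`, lies in
`𝒪_{k-alg}(𝔻̄^∞)` (landed W2, S4, S8). [cite: Ayoub2015, Conj. 1.1] -/
theorem f2_relAC_mem_Oan {k : Type} [Field k] [CharZero k] (σ : k →+* ℂ) {G : CSeries}
    (hG : G ∈ Oan σ) (n : ℕ) : relAC n G ∈ Oan σ :=
  add_mem_Oan σ (sub_mem_Oan σ (stub_pdzMemOan stub_pdzCalculus k σ G hG n).1
    (stub_restrCOne k σ G hG n).1) (stub_restrCZeroMemOan k σ G hG n).1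

/-- The `k`-span of the type-(a) elements lies in `𝒪_{k-alg}(𝔻̄^∞)` (the scalars `σ c` are
algebraic over `k` along `σ`: roots of `Y − c`). [folklore] -/
theorem f2_mem_Oan_of_mem_span {k : Type} [Field k] [CharZero k] (σ : k →+* ℂ) {x : CSeries}
    (hx : x ∈ kSpan σ {x : CSeries | ∃ G ∈ Oan σ, ∃ n : ℕ, x = relAC n G}) : x ∈ Oan σ := by
  obtain ⟨n, c, s, hs, rfl⟩ := hx
  refine c3_sum_mem_Oan σ _ _ fun j _ => ?_
  obtain ⟨G, hG, l, hl⟩ := hs j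
  rw [hl]
  refine smul_mem_Oan σ ⟨Polynomial.X - Polynomial.C (c j), Polynomial.X_sub_C_ne_zero _, ?_⟩
    (f2_relAC_mem_Oan σ hG l)
  rw [Polynomial.eval₂_sub, Polynomial.eval₂_X, Polynomial.eval₂_C, sub_self]

/-! ## Variables of sums and of transposed series -/

/-- A finite sum involves a variable only if a summand does. [folklore] -/
theorem f2_usesVar_sum {ι : Type*} (s : Finset ι) (g : ι → CSeries) {l : ℕ}
    (h : UsesVar (∑ p ∈ s, g p) l) : ∃ p ∈ s, UsesVar (g p) l := by
  classical
  induction s using Finset.induction_on with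
  | empty =>
    rw [Finset.sum_empty] at h
    exact absurd h (not_usesVar_zero l)
  | insert a s ha ih =>
    rw [Finset.sum_insert ha] at h
    rcases s6_usesVar_add h with h1 | h1
    · exact ⟨a, Finset.mem_insert_self a s, h1⟩
    · obtain ⟨p, hp, hp'⟩ := ih h1
      exact ⟨p, Finset.mem_insert_of_mem hp, hp'⟩

/-- The transposed series `F^{(i j)}` of a series `F` involving only `zᵢ` involves only `z_j`.
[folklore] -/
theorem f2_usesVar_rename_swap {F : CSeries} {i j : ℕ} (hF : ∀ l : ℕ, UsesVar F l → l = i)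
    {l : ℕ} (h : UsesVar (MvPowerSeries.rename (⇑(Equiv.swap i j)) F) l) : l = j := by
  obtain ⟨a, hal, ha⟩ := h
  rw [s1_coeff_rename_swap] at ha
  have h1 : UsesVar F (Equiv.swap i j l) := by
    refine ⟨mapDomain (⇑(Equiv.swap i j)) a, ?_, ha⟩
    rwa [mapDomain_equiv_apply, Equiv.symm_swap, Equiv.swap_apply_self]
  have h2 := congrArg (⇑(Equiv.swap i j)) (hF _ h1)
  rwa [Equiv.swap_apply_self, Equiv.swap_apply_left] at h2

/-- Renaming `zᵢ ↔ z_j` turns `p(zᵢ)` into `p(z_j)`. [folklore] -/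
theorem f2_rename_swap_aeval (i j : ℕ) (p : Polynomial ℂ) :
    MvPowerSeries.rename (⇑(Equiv.swap i j)) (Polynomial.aeval (X i : CSeries) p) =
      Polynomial.aeval (X j : CSeries) p := by
  rw [← Polynomial.aeval_algHom_apply, MvPowerSeries.rename_X, Equiv.swap_apply_left]

/-! ## Sums of one-variable rational elements -/

/-- Products of polynomials with algebraic coefficients have algebraic coefficients.
[folklore] -/
theorem f2_isAlgebraic_coeff_mul {A B : Polynomial ℂ} (hA : ∀ n, IsAlgebraic ℚ (A.coeff n))
    (hB : ∀ n, IsAlgebraic ℚ (B.coeff n)) (n : ℕ) : IsAlgebraic ℚ ((A * B).coeff n) := by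
  rw [Polynomial.coeff_mul]
  exact l1_isAlgebraic_sum _ _ fun x _ => (hA x.1).mul (hB x.2)

/-- One-variable rational elements in a fixed variable `z_t` (with algebraic coefficients) are
stable under finite sums: `(Π_p B_p) · Σ_p g_p = Σ_p A_p Π_{q ≠ p} B_q`, by induction
(`B₁B₂ (g + r) = A₁B₂ + A₂B₁`). [folklore] -/
theorem f2_rat_sum {ι : Type*} (s : Finset ι) (t : ℕ) (g : ι → CSeries)
    (hg : ∀ p ∈ s, ∃ A B : Polynomial ℂ, B ≠ 0 ∧ (∀ n, IsAlgebraic ℚ (A.coeff n)) ∧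
      (∀ n, IsAlgebraic ℚ (B.coeff n)) ∧
      Polynomial.aeval (X t : CSeries) B * g p = Polynomial.aeval (X t : CSeries) A) :
    ∃ A B : Polynomial ℂ, B ≠ 0 ∧ (∀ n, IsAlgebraic ℚ (A.coeff n)) ∧
      (∀ n, IsAlgebraic ℚ (B.coeff n)) ∧
      Polynomial.aeval (X t : CSeries) B * ∑ p ∈ s, g p = Polynomial.aeval (X t : CSeries) A := by
  classical
  induction s using Finset.induction_on with
  | empty =>
    refine ⟨0, 1, one_ne_zero, fun n => ?_, fun n => ?_, ?_⟩
    · rw [Polynomial.coeff_zero]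
      exact isAlgebraic_zero
    · rw [Polynomial.coeff_one]
      split_ifs
      · exact isAlgebraic_one
      · exact isAlgebraic_zero
    · rw [Finset.sum_empty, mul_zero, map_zero]
  | insert a s ha ih =>
    obtain ⟨A₁, B₁, hB₁, hA₁c, hB₁c, h₁⟩ := hg a (Finset.mem_insert_self a s)
    obtain ⟨A₂, B₂, hB₂, hA₂c, hB₂c, h₂⟩ := ih fun p hp => hg p (Finset.mem_insert_of_mem hp)
    refine ⟨A₁ * B₂ + A₂ * B₁, B₁ * B₂, mul_ne_zero hB₁ hB₂, fun n => ?_,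
      f2_isAlgebraic_coeff_mul hB₁c hB₂c, ?_⟩
    · rw [Polynomial.coeff_add]
      exact (f2_isAlgebraic_coeff_mul hA₁c hB₂c n).add (f2_isAlgebraic_coeff_mul hA₂c hB₁c n)
    · rw [Finset.sum_insert ha, map_mul, map_add, map_mul, map_mul]
      linear_combination (Polynomial.aeval (X t : CSeries) B₂) * h₁ +
        (Polynomial.aeval (X t : CSeries) B₁) * h₂

/-! ## Registered form -/

/-- **F2 — finite sums of one-variable rational pieces with vanishing TOTAL integral are
type (a).** For `h_p ∈ 𝒪_{ℚ-alg}(𝔻̄^∞)` involving only `z_{ι p}` and rational in it with algebraic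
coefficients, `∫ Σ_p h_p = 0 ⟹ Σ_p h_p ∈ ⟨a⟩_ℚ`: move each piece to a common fresh variable `z_t`
by the transposition certificate (Ayoub Rem. 1.5, landed `stub_transposition`), so that
`Σ_p h_p ≡ H := Σ_p h_p^{(ι p t)}` modulo the span; `H` is one-variable, rational (common
denominator), in `𝒪_{ℚ-alg}(𝔻̄^∞)` (the span lies in it) and `∫ H = 0` (the span integrates to
zero), so LAYER 1 (`l1_layer_rat`) applies to `H`. [cite: Ayoub2015, Conj. 1.1] -/
theorem stub_multiPieceRatLayer :
    ∀ (m : ℕ) (ι : Fin m → ℕ) (h : Fin m → CSeries), (∀ p, h p ∈ Oan (algebraMap ℚ ℂ)) →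
      (∀ p (l : ℕ), UsesVar (h p) l → l = ι p) →
      (∀ p, ∃ A B : Polynomial ℂ, B ≠ 0 ∧ (∀ n, IsAlgebraic ℚ (A.coeff n)) ∧
        (∀ n, IsAlgebraic ℚ (B.coeff n)) ∧
        Polynomial.aeval (X (ι p) : CSeries) B * h p = Polynomial.aeval (X (ι p) : CSeries) A) →
      intC (∑ p, h p) = 0 →
      ∑ p, h p ∈ kSpan (algebraMap ℚ ℂ) {x : CSeries | ∃ G ∈ Oan (algebraMap ℚ ℂ), ∃ n : ℕ, x = relAC n G} := by
  intro m ι h hOan hvar hrat h0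
  -- a fresh common variable `z_t`
  obtain ⟨t, hιt⟩ : ∃ t : ℕ, ∀ p, ι p ≠ t :=
    ⟨Finset.univ.sup ι + 1, fun p hp => by
      have h1 : ι p ≤ Finset.univ.sup ι := Finset.le_sup (f := ι) (Finset.mem_univ p)
      omega⟩
  -- the moved pieces `h' p = (h p)^{(ι p t)}`
  obtain ⟨h', hh'⟩ : ∃ h' : Fin m → CSeries,
      ∀ p, h' p = MvPowerSeries.rename (⇑(Equiv.swap (ι p) t)) (h p) := ⟨_, fun p => rfl⟩
  have hdiff : ∀ p, h p - h' p ∈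
      kSpan (algebraMap ℚ ℂ) {x : CSeries | ∃ G ∈ Oan (algebraMap ℚ ℂ), ∃ n : ℕ, x = relAC n G} :=
    fun p => by
      rw [hh']
      exact stub_transposition ℚ (algebraMap ℚ ℂ) (h p) (hOan p) (ι p) t (hιt p)
        fun hu => hιt p (hvar p t hu).symm
  have h'Oan : ∀ p, h' p ∈ Oan (algebraMap ℚ ℂ) := fun p => by
    rw [← sub_sub_cancel (h p) (h' p)]
    exact sub_mem_Oan _ (hOan p) (f2_mem_Oan_of_mem_span _ (hdiff p))
  have h'var : ∀ p (l : ℕ), UsesVar (h' p) l → l = t := fun p l hl => by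
    rw [hh'] at hl
    exact f2_usesVar_rename_swap (hvar p) hl
  have h'rat : ∀ p, ∃ A B : Polynomial ℂ, B ≠ 0 ∧ (∀ n, IsAlgebraic ℚ (A.coeff n)) ∧
      (∀ n, IsAlgebraic ℚ (B.coeff n)) ∧
      Polynomial.aeval (X t : CSeries) B * h' p = Polynomial.aeval (X t : CSeries) A := by
    intro p
    obtain ⟨A, B, hB, hAc, hBc, hBF⟩ := hrat p
    refine ⟨A, B, hB, hAc, hBc, ?_⟩
    have e := congrArg (MvPowerSeries.rename (⇑(Equiv.swap (ι p) t))) hBF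
    rw [map_mul, f2_rename_swap_aeval, f2_rename_swap_aeval, ← hh'] at e
    exact e
  -- the moved sum `H = Σ h' p`
  have hHOan : ∑ p, h' p ∈ Oan (algebraMap ℚ ℂ) := c3_sum_mem_Oan _ _ _ fun p _ => h'Oan p
  have hHvar : ∀ l : ℕ, UsesVar (∑ p, h' p) l → l = t := fun l hl => by
    obtain ⟨p, -, hp⟩ := f2_usesVar_sum _ _ hl
    exact h'var p l hp
  have hHrat := f2_rat_sum Finset.univ t h' fun p _ => h'rat p
  have hsub : ∑ p, h p - ∑ p, h' p ∈
      kSpan (algebraMap ℚ ℂ) {x : CSeries | ∃ G ∈ Oan (algebraMap ℚ ℂ), ∃ n : ℕ, x = relAC n G} := by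
    rw [← Finset.sum_sub_distrib]
    exact l1_sum_mem_span _ _ fun p _ => hdiff p
  have hH0 : intC (∑ p, h' p) = 0 := by
    have hS : Summable fun a : ℕ →₀ ℕ => ‖coeff a (∑ p, h p)‖ :=
      summable_norm_coeff_of_mem_Oan (algebraMap ℚ ℂ) (c3_sum_mem_Oan _ _ _ fun p _ => hOan p)
    have e := intC_sub hS (summable_norm_coeff_of_mem_kSpan_relAC (algebraMap ℚ ℂ) hsub)
    rw [sub_sub_cancel, h0, intC_eq_zero_of_mem_kSpan_relAC (algebraMap ℚ ℂ) hsub,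
      sub_zero] at e
    exact e
  -- Layer 1 on `H`, and `Σ h p = (Σ h p − H) + H`
  have hH := l1_layer_rat t (∑ p, h' p) hHOan hHvar hHrat hH0
  have e := kSpan_add _ hsub hH
  rwa [sub_add_cancel] at e

end Summit.KontsevichZagierPeriods.KontsevichZagierPeriods.TypeAGenerationLine
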